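import Mathlib
import Summits.ValiantsHypothesis.ValiantsHypothesis.Theorems.NewtonUnitEquationsDissociatedUniformTotalsLawConeSweep
import HarnessLib

/-!
# Crux `NewtonUnitEquations.DissociatedUniform` (stmt-ValiantsHypothesis-5905): the CONE SWEEP COUNT — vertices of a sharp-topped
# curve exposed inside the normal cone of one vertex of a strictly convex polygon are `1 +` the exposed EDGES

Memo `Cruxes/DissociatedUniform/NOTES-t1g8.md` §2 ("`V_s = q + Σ_z #(E_{s−z} ∩ K_z)`") / §5(i).  With the ingredients of `…TotalsLawConeSweep`
(normal cone of a vertex swept by the cone path; sharp tops; the abstract sweep lemma on `[0,1]`):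

* **`card_commonTop_le`**: for a strictly convex ccw polygon `c` (`q ≥ 3`), a vertex `z`, and ANY curve `P` with `SharpTops P`,
  `#{x : ∃ θ ≠ 0, WTop c θ z ∧ WTop P θ x} ≤ 1 + #{x : ∃ θ ≠ 0, WTop c θ z ∧ WTop P θ x ∧ WTop P θ (x+1)}`.
Proof: sweep the cone from `perp Δ(z−1)` to `perp Δ z`; the tops present at time `0` are one vertex or the two ends of one exposed edge;
every later top `x` has a first time `t_x > 0`, shared (closed finite cover) with another top, which by sharpness is `x ± 1` — an edge
exposed inside the cone; two tops cannot enter through each other (a third top would be present at the common time), so the charge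
top ↦ edge is injective and misses the edge present at time `0`.
In the dominant-third-curve regime this turns `…LargeThirdPointwise.classVert_smul_le_card_commonDir` into
`V_s ≤ q + #{(z, x) : edge {x, x+1} of P_{s−z} exposed inside K_z}` for fibres with sharp tops (`…TotalsLawRigidPairs`).
Honest label: a counting lemma; `CoOrientedClassBound`, `SmoothSharpTotalsLaw`, `TotalsLawThree` remain OPEN; nothing here bears on VP ≠ VNP.
[folklore]
-/

set_option linter.dupNamespace false -- `ValiantsHypothesis.ValiantsHypothesis` (summit = problem) in every name

open scoped BigOperators

namespace Summit.ValiantsHypothesis.ValiantsHypothesis.Theorems.NewtonUnitEquationsDissociatedUniform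

namespace TotalsLaw

open Matrix Set

/-! ### The cone sweep count -/

section Count

variable {q : ℕ} [NeZero q]

omit [NeZero q] in
/-- A functional along the cone path is continuous in the time. [folklore] -/
theorem continuous_conePath_dotProduct (c : ZMod q → (Fin 2 → ℝ)) (z : ZMod q) (v : Fin 2 → ℝ) :
    Continuous fun t : ℝ => conePath c z t ⬝ᵥ v := by
  have : (fun t : ℝ => conePath c z t ⬝ᵥ v) =
      fun t : ℝ => (1 - t) * (perp (edgeVec c (z - 1)) ⬝ᵥ v) + t * (perp (edgeVec c z) ⬝ᵥ v) := by
    funext t; exact conePath_dotProduct c z t v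
  rw [this]
  fun_prop

omit [NeZero q] in
/-- The set of times at which `x` is a weak top along the cone path is closed. [folklore] -/
theorem isClosed_wTop_conePath (c : ZMod q → (Fin 2 → ℝ)) (z : ZMod q) (P : ZMod q → (Fin 2 → ℝ)) (x : ZMod q) :
    IsClosed {t : ℝ | WTop P (conePath c z t) x} := by
  have : {t : ℝ | WTop P (conePath c z t) x} = ⋂ x' : ZMod q, {t : ℝ | conePath c z t ⬝ᵥ P x' ≤ conePath c z t ⬝ᵥ P x} := by
    ext t; simp [WTop]
  rw [this]
  exact isClosed_iInter fun x' =>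
    isClosed_le (continuous_conePath_dotProduct c z (P x')) (continuous_conePath_dotProduct c z (P x))

omit [NeZero q] in
/-- Along the cone path of the vertex `z`: "common weak-top direction with `c z`" is "weak top at some time `t ∈ [0,1]`". [folklore] -/
theorem commonTop_iff_conePath {c : ZMod q → (Fin 2 → ℝ)} (hc : StrictlyConvexCcw c) (hq : 3 ≤ q) (z : ZMod q)
    (P : ZMod q → (Fin 2 → ℝ)) (x : ZMod q) :
    (∃ θ : Fin 2 → ℝ, θ ≠ 0 ∧ WTop c θ z ∧ WTop P θ x) ↔ ∃ t ∈ Icc (0 : ℝ) 1, WTop P (conePath c z t) x := by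
  constructor
  · rintro ⟨θ, hθ, hz, hx⟩
    obtain ⟨t, ht, r, hr, rfl⟩ := exists_conePath_of_wTop hc hq z hθ hz
    exact ⟨t, ht, (wTop_smul_iff P hr x).1 hx⟩
  · rintro ⟨t, ht, hx⟩
    exact ⟨conePath c z t, conePath_ne_zero hc hq z t, wTop_conePath hc hq z ht, hx⟩

open scoped Classical in
/-- **THE CONE SWEEP COUNT.**  For a strictly convex ccw polygon `c` (`q ≥ 3`), a vertex `z`, and any curve `P` with sharp tops:
the labels of `P` sharing a non-zero weak-top weight with `c z` number at most one plus the labels `x` such that the EDGE `{x, x+1}`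
of `P` shares a weak-top weight with `c z`.  (Sweep the normal cone of `c z` from one bounding normal to the other: the tops present at
the start are one vertex or one edge; every later top enters through an edge exposed inside the cone, injectively.) [folklore] -/
theorem card_commonTop_le {c : ZMod q → (Fin 2 → ℝ)} (hc : StrictlyConvexCcw c) (hq : 3 ≤ q)
    {P : ZMod q → (Fin 2 → ℝ)} (hP : SharpTops P) (z : ZMod q) :
    (Finset.univ.filter fun x : ZMod q => ∃ θ : Fin 2 → ℝ, θ ≠ 0 ∧ WTop c θ z ∧ WTop P θ x).card ≤
      1 + (Finset.univ.filter fun x : ZMod q =>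
        ∃ θ : Fin 2 → ℝ, θ ≠ 0 ∧ WTop c θ z ∧ WTop P θ x ∧ WTop P θ (x + 1)).card := by
  -- the sweep data
  set θp := conePath c z with hθp
  set T : ZMod q → Set ℝ := fun x => {t : ℝ | WTop P (θp t) x} with hT
  have hTc : ∀ x, IsClosed (T x) := fun x => isClosed_wTop_conePath c z P x
  have hcov : ∀ s ∈ Icc (0 : ℝ) 1, ∃ x, s ∈ T x := fun s _ => exists_wTop P (θp s)
  have hne : ∀ s, θp s ≠ 0 := fun s => conePath_ne_zero hc hq z s
  have h2 : ∀ s ∈ Icc (0 : ℝ) 1, ∀ x y w : ZMod q, s ∈ T x → s ∈ T y → s ∈ T w → x = y ∨ y = w ∨ x = w :=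
    fun s _ x y w hx hy hw => (hP (θp s) (hne s)).2 x y w hx hy hw
  have hadj : ∀ s, ∀ x y : ZMod q, s ∈ T x → s ∈ T y → y = x ∨ y = x + 1 ∨ x = y + 1 :=
    fun s x y hx hy => (hP (θp s) (hne s)).1 x y hx hy
  set S := Finset.univ.filter fun x : ZMod q => ∃ θ : Fin 2 → ℝ, θ ≠ 0 ∧ WTop c θ z ∧ WTop P θ x with hS
  set E := Finset.univ.filter fun x : ZMod q =>
    ∃ θ : Fin 2 → ℝ, θ ≠ 0 ∧ WTop c θ z ∧ WTop P θ x ∧ WTop P θ (x + 1) with hE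
  have hmemS : ∀ x, x ∈ S ↔ ∃ t ∈ Icc (0 : ℝ) 1, t ∈ T x := fun x => by
    rw [hS, Finset.mem_filter, commonTop_iff_conePath hc hq z P x]
    simp only [Finset.mem_univ, true_and, hT, hθp, Set.mem_setOf_eq]
  have hmemE : ∀ x, ∀ t ∈ Icc (0 : ℝ) 1, t ∈ T x → t ∈ T (x + 1) → x ∈ E := fun x t ht h1 h2' => by
    rw [hE, Finset.mem_filter]
    exact ⟨Finset.mem_univ _, θp t, hne t, wTop_conePath hc hq z ht, h1, h2'⟩
  have h0I : (0 : ℝ) ∈ Icc (0 : ℝ) 1 := ⟨le_rfl, zero_le_one⟩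
  -- tops at the start of the sweep / the others
  set S₀ := S.filter fun x => (0 : ℝ) ∈ T x with hS₀
  set S' := S.filter fun x => (0 : ℝ) ∉ T x with hS'
  set E₀ := E.filter fun e => (0 : ℝ) ∈ T e ∧ (0 : ℝ) ∈ T (e + 1) with hE₀
  have hcardS : S₀.card + S'.card = S.card := Finset.card_filter_add_card_filter_not _
  have hE₀E : E₀ ⊆ E := Finset.filter_subset _ _
  -- (iii) the start: at most one vertex, or one edge
  have hstart : S₀.card ≤ 1 + E₀.card := by
    by_cases h1 : S₀.card ≤ 1
    · omega
    · obtain ⟨a, ha, b, hb, hab⟩ := Finset.one_lt_card.1 (show 1 < S₀.card by omega)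
      have ha0 : (0 : ℝ) ∈ T a := (Finset.mem_filter.1 ha).2
      have hb0 : (0 : ℝ) ∈ T b := (Finset.mem_filter.1 hb).2
      -- an edge at time 0
      have hE₀pos : 1 ≤ E₀.card := by
        apply Finset.card_pos.2
        rcases hadj 0 a b ha0 hb0 with h | h | h
        · exact absurd h.symm hab
        · refine ⟨a, Finset.mem_filter.2 ⟨hmemE a 0 h0I ha0 (h ▸ hb0), ha0, h ▸ hb0⟩⟩
        · refine ⟨b, Finset.mem_filter.2 ⟨hmemE b 0 h0I hb0 (h ▸ ha0), hb0, h ▸ ha0⟩⟩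
      -- never three tops
      have hS₀2 : S₀.card ≤ 2 := by
        by_contra h3
        obtain ⟨u, hu, v, hv, w, hw, huv, huw, hvw⟩ := Finset.two_lt_card.1 (show 2 < S₀.card by omega)
        rcases h2 0 h0I u v w (Finset.mem_filter.1 hu).2 (Finset.mem_filter.1 hv).2 (Finset.mem_filter.1 hw).2 with h | h | h
        · exact huv h
        · exact hvw h
        · exact huw h
      omega
  -- (ii) the entries: each later top enters through an exposed edge, injectively
  have hentry : ∀ x, x ∈ S' → ∃ t e, (t ∈ Icc (0 : ℝ) 1 ∧ 0 < t ∧ (∀ s ∈ Icc (0 : ℝ) 1, s ∈ T x → t ≤ s)) ∧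
      (e = x ∨ e + 1 = x) ∧ t ∈ T e ∧ t ∈ T (e + 1) := by
    intro x hx
    obtain ⟨hxS, hx0⟩ := Finset.mem_filter.1 hx
    obtain ⟨t₀, ht₀, hxt₀⟩ := (hmemS x).1 hxS
    obtain ⟨t, ht, htx, htpos, hmin, y, hyx, hty⟩ := exists_min_mem_other T hTc hcov ht₀ hxt₀ hx0
    rcases hadj t x y htx hty with h | h | h
    · exact absurd h hyx
    · exact ⟨t, x, ⟨ht, htpos, hmin⟩, Or.inl rfl, htx, h ▸ hty⟩
    · exact ⟨t, y, ⟨ht, htpos, hmin⟩, Or.inr h.symm, hty, h ▸ htx⟩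
  choose! tt ee hent using hentry
  have hmaps : ∀ x ∈ S', ee x ∈ E \ E₀ := by
    intro x hx
    obtain ⟨⟨ht, -, -⟩, hex, hte, hte1⟩ := hent x hx
    have hx0 : (0 : ℝ) ∉ T x := (Finset.mem_filter.1 hx).2
    refine Finset.mem_sdiff.2 ⟨hmemE _ _ ht hte hte1, fun h0 => ?_⟩
    obtain ⟨-, h0e, h0e1⟩ := Finset.mem_filter.1 h0
    rcases hex with h | h
    · exact hx0 (h ▸ h0e)
    · exact hx0 (h ▸ h0e1)
  have hinj : Set.InjOn ee S' := by
    intro x hx x' hx' hee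
    by_contra hxx'
    obtain ⟨⟨ht, htpos, hmin⟩, hex, hte, hte1⟩ := hent x hx
    obtain ⟨⟨ht', -, hmin'⟩, hex', hte', hte1'⟩ := hent x' hx'
    simp only [Finset.mem_coe] at hx hx'
    rcases hex with h | h <;> rcases hex' with h' | h'
    · exact hxx' (h.symm.trans (hee.trans h'))
    · -- ee x = x, ee x' + 1 = x' with ee x = ee x' : x' = x + 1
      have hx'eq : x' = ee x + 1 := by rw [hee, h']
      have hxeq : x = ee x' := by rw [← hee, h]
      refine not_mutual_min T hTc hcov h2 hxx' ht htpos hmin ht' hmin' ?_ ?_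
      · -- t ∈ T x'
        rw [hx'eq]; exact hte1
      · -- t' ∈ T x
        rw [hxeq]; exact hte'
    · have hxeq : x = ee x' + 1 := by rw [← hee, h]
      have hx'eq : x' = ee x := by rw [hee, h']
      refine not_mutual_min T hTc hcov h2 hxx' ht htpos hmin ht' hmin' ?_ ?_
      · rw [hx'eq]; exact hte
      · rw [hxeq]; exact hte1'
    · exact hxx' (h.symm.trans ((congrArg (· + 1) hee).trans h'))
  have hS'le : S'.card ≤ (E \ E₀).card := Finset.card_le_card_of_injOn ee hmaps hinj
  have hsd : (E \ E₀).card = E.card - E₀.card := Finset.card_sdiff_of_subset hE₀E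
  have hE₀le : E₀.card ≤ E.card := Finset.card_le_card hE₀E
  omega

end Count

end TotalsLaw

end Summit.ValiantsHypothesis.ValiantsHypothesis.Theorems.NewtonUnitEquationsDissociatedUniform
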